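import Summits.CriticalPhenomena.Ising3D.Control2DChiralMono
import Summits.CriticalPhenomena.Ising3D.Control2DTail
import Mathlib.Tactic.Linarith
import Mathlib.Tactic.Positivity
import Mathlib.Tactic.FieldSimp
import Mathlib.Tactic.Ring
import HarnessLib

/-!
# The 2D control: the truncation lower bound for obligation (C) — proved
(cell `pub-ising3x`, seat controls-1; mathematics of the kernel checker for obligation (C))

HONEST FRAMING: lottery ticket; floor = tightest certified 3D Ising CFT bounds; no exact-solution
claim without a proof.

Obligation (C) of a 2D gap certificate asks `φ[F_-[g_{Δ,ℓ}]] ≥ 0` for the blocks BELOW the series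
threshold, `ℓ ≤ Δ < E₀`. The verifiers (and the kernel checker) decide it on the TRUNCATED block: by
the pair-monomial expansion (`Control2DTermwise.hasSum_crossF_globalBlock`)
`φ[F_-[g_{Δ,ℓ}]] = Σ_{m,m'} a_m(h) a_{m'}(h̄) φ[F_-[pairPow (h+m) (h̄+m')]]`, and every term with
`m ≥ N` or `m' ≥ N` has `(h+m) + (h̄+m') = Δ + m + m' ≥ Δ + N ≥ E₀`, hence is `≥ 0` by the
above-threshold obligation (M)+(T) (`PairPositiveAbove φ s E₀`). So
`φ[F_-[g_{Δ,ℓ}]] ≥ T_N(Δ) := Σ_{m,m'<N} a_m a_{m'} φ[F_-[pairPow (h+m) (h̄+m')]] = φ[F_-[Q_N]]`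
(`blockPositive_of_QN_nonneg`), where the truncated block `Q_N` has the CLOSED FORM
`Q_N(x,y) = (xy)^{Δ/2} · brR N ℓ Δ x y` (`QN_eq`; `brR` from `Control2DChiralMono.lean`), and for a
point functional `φ[F_-[Q_N]] = Σ_k w_k (v_k^s (z_k z̄_k)^{Δ/2} brR(z_k,z̄_k) - u_k^s ((1-z_k)(1-z̄_k))^{Δ/2} brR(1-z_k,1-z̄_k))`
(`pointFunctional_crossF_QN`) — the expression the kernel cell checker bounds from below on each
`Δ`-cell. This is verifier A's step "(C) … A_N = partial sum m < N, N ≥ E0 - d1 on the cell: every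
dropped pair contributes ≥ 0 by (M)/(T)" (`verify_points2d.py` docstring), typed and proved.
-/

namespace Summit.CriticalPhenomena.Ising3D.Control2D

open Set Finset
open Literature.MathematicalPhysics.QuantumFieldTheory.ConformalBootstrap3D

/-! ### The truncated block and its closed form -/

/-- The truncated block `Q_N(x,y) = Σ_{m,m'<N} a_m(h) a_{m'}(h̄) pairPow (h+m) (h̄+m') (x,y)`,
`h = (Δ+ℓ)/2`, `h̄ = (Δ-ℓ)/2`. [folklore] -/
noncomputable def QN (N ℓ : ℕ) (Δ : ℝ) (x y : ℝ) : ℝ :=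
  ∑ m ∈ range N, ∑ m' ∈ range N,
    chiralCoeff ((Δ + ℓ) / 2) m * chiralCoeff ((Δ - ℓ) / 2) m' *
      pairPow ((Δ + ℓ) / 2 + m) ((Δ - ℓ) / 2 + m') x y

/-- `x^h y^{h̄} = (xy)^{Δ/2} (x/y)^{ℓ/2}` for even `ℓ`, `x, y > 0` (`h = (Δ+ℓ)/2`, `h̄ = (Δ-ℓ)/2`).
[folklore] -/
theorem rpow_h_mul_rpow_hb {ℓ : ℕ} (hℓ : Even ℓ) {Δ x y : ℝ} (hx : 0 < x) (hy : 0 < y) :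
    x ^ ((Δ + ℓ) / 2) * y ^ ((Δ - ℓ) / 2) = (x * y) ^ (Δ / 2) * (x / y) ^ (ℓ / 2) := by
  obtain ⟨p, hp⟩ := hℓ
  have hp2 : ℓ / 2 = p := by omega
  have hℓp : (ℓ : ℝ) / 2 = (p : ℝ) := by rw [hp]; push_cast; ring
  rw [hp2, show (Δ + ℓ) / 2 = Δ / 2 + (ℓ : ℝ) / 2 by ring,
    show (Δ - ℓ) / 2 = Δ / 2 - (ℓ : ℝ) / 2 by ring, hℓp, Real.rpow_add hx, Real.rpow_sub hy,
    Real.rpow_natCast, Real.rpow_natCast, Real.mul_rpow hx.le hy.le, div_pow]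
  field_simp

/-- **Closed form of the truncated block**: `Q_N(x,y) = (xy)^{Δ/2} brR N ℓ Δ x y` for even `ℓ` and
`x, y > 0`. [folklore] -/
theorem QN_eq {N ℓ : ℕ} (hℓ : Even ℓ) {Δ x y : ℝ} (hx : 0 < x) (hy : 0 < y) :
    QN N ℓ Δ x y = (x * y) ^ (Δ / 2) * brR N ℓ Δ x y := by
  have e1 := rpow_h_mul_rpow_hb (Δ := Δ) hℓ hx hy
  have e2 := rpow_h_mul_rpow_hb (Δ := Δ) hℓ hy hx
  -- expand the pair monomials
  have hterm : ∀ m m' : ℕ, pairPow ((Δ + ℓ) / 2 + m) ((Δ - ℓ) / 2 + m') x y =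
      (x * y) ^ (Δ / 2) * ((x / y) ^ (ℓ / 2) * (x ^ m * y ^ m') + (y / x) ^ (ℓ / 2) * (x ^ m' * y ^ m)) := by
    intro m m'
    unfold pairPow
    rw [Real.rpow_add hx, Real.rpow_add hy, Real.rpow_add hx, Real.rpow_add hy, Real.rpow_natCast,
      Real.rpow_natCast, Real.rpow_natCast, Real.rpow_natCast, mul_comm x y] at *
    rw [mul_comm y x]
    have e2' : y ^ ((Δ + ↑ℓ) / 2) * x ^ ((Δ - ↑ℓ) / 2) = (x * y) ^ (Δ / 2) * (y / x) ^ (ℓ / 2) := by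
      rw [mul_comm x y]; exact e2
    calc x ^ ((Δ + ↑ℓ) / 2) * x ^ m * (y ^ ((Δ - ↑ℓ) / 2) * y ^ m') +
          x ^ ((Δ - ↑ℓ) / 2) * x ^ m' * (y ^ ((Δ + ↑ℓ) / 2) * y ^ m)
        = (x ^ ((Δ + ↑ℓ) / 2) * y ^ ((Δ - ↑ℓ) / 2)) * (x ^ m * y ^ m') +
          (y ^ ((Δ + ↑ℓ) / 2) * x ^ ((Δ - ↑ℓ) / 2)) * (x ^ m' * y ^ m) := by ring
      _ = _ := by rw [e1, e2']; ring
  unfold QN brR AN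
  simp_rw [hterm]
  have eq1 : (x / y) ^ (ℓ / 2) * (∑ m ∈ range N, chiralCoeff ((Δ + ℓ) / 2) m * x ^ m) *
      (∑ m ∈ range N, chiralCoeff ((Δ - ℓ) / 2) m * y ^ m) =
      ∑ m ∈ range N, ∑ m' ∈ range N, chiralCoeff ((Δ + ℓ) / 2) m * chiralCoeff ((Δ - ℓ) / 2) m' *
        ((x / y) ^ (ℓ / 2) * (x ^ m * y ^ m')) := by
    rw [mul_assoc, Finset.sum_mul_sum, Finset.mul_sum]
    refine Finset.sum_congr rfl fun m _ => ?_
    rw [Finset.mul_sum]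
    refine Finset.sum_congr rfl fun m' _ => ?_
    ring
  have eq2 : (y / x) ^ (ℓ / 2) * (∑ m ∈ range N, chiralCoeff ((Δ - ℓ) / 2) m * x ^ m) *
      (∑ m ∈ range N, chiralCoeff ((Δ + ℓ) / 2) m * y ^ m) =
      ∑ m ∈ range N, ∑ m' ∈ range N, chiralCoeff ((Δ + ℓ) / 2) m * chiralCoeff ((Δ - ℓ) / 2) m' *
        ((y / x) ^ (ℓ / 2) * (x ^ m' * y ^ m)) := by
    rw [mul_assoc, Finset.sum_mul_sum, Finset.mul_sum, Finset.sum_comm]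
    refine Finset.sum_congr rfl fun m _ => ?_
    rw [Finset.mul_sum]
    refine Finset.sum_congr rfl fun m' _ => ?_
    ring
  rw [eq1, eq2, ← Finset.sum_add_distrib, Finset.mul_sum]
  refine Finset.sum_congr rfl fun m _ => ?_
  rw [← Finset.sum_add_distrib, Finset.mul_sum]
  refine Finset.sum_congr rfl fun m' _ => ?_
  ring

/-! ### Linearity: `T_N = φ[F_-[Q_N]]` -/

/-- `crossF` is additive in the block. [folklore] -/
theorem crossF_add (s σ : ℝ) (f g : ℝ → ℝ → ℝ) :
    crossF s σ (fun x y => f x y + g x y) = fun z zb => crossF s σ f z zb + crossF s σ g z zb := by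
  funext z zb; simp only [crossF]; ring

/-- `crossF` commutes with scalars in the block. [folklore] -/
theorem crossF_smul (s σ c : ℝ) (f : ℝ → ℝ → ℝ) :
    crossF s σ (fun x y => c * f x y) = fun z zb => c * crossF s σ f z zb := by
  funext z zb; simp only [crossF]; ring

/-- `crossF` of a finite sum of blocks. [folklore] -/
theorem crossF_finset_sum {ι : Type} (s σ : ℝ) (S : Finset ι) (c : ι → ℝ) (g : ι → ℝ → ℝ → ℝ) :
    crossF s σ (fun x y => ∑ i ∈ S, c i * g i x y) = fun z zb => ∑ i ∈ S, c i * crossF s σ (g i) z zb := by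
  classical
  induction S using Finset.induction_on with
  | empty => funext z zb; simp [crossF]
  | insert a S ha ih =>
    funext z zb
    have hsplit : (fun x y => ∑ i ∈ insert a S, c i * g i x y) =
        fun x y => c a * g a x y + ∑ i ∈ S, c i * g i x y := by
      funext x y; rw [Finset.sum_insert ha]
    rw [hsplit, crossF_add, Finset.sum_insert ha, crossF_smul]
    simp only
    rw [ih]

/-- **`T_N(Δ) = φ[F_-[Q_N]]`**: the truncated double sum of `φ`-values is `φ` of the truncated block,
for any linear `φ`. [folklore] -/
theorem TN_eq_phi_QN (φ : (ℝ → ℝ → ℝ) →ₗ[ℝ] ℝ) (s : ℝ) (N ℓ : ℕ) (Δ : ℝ) :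
    ∑ m ∈ range N, ∑ m' ∈ range N,
        chiralCoeff ((Δ + ℓ) / 2) m * chiralCoeff ((Δ - ℓ) / 2) m' *
          φ (crossF s (-1) (pairPow ((Δ + ℓ) / 2 + m) ((Δ - ℓ) / 2 + m'))) =
      φ (crossF s (-1) (QN N ℓ Δ)) := by
  have hQ : QN N ℓ Δ = fun x y => ∑ mm ∈ range N ×ˢ range N,
      (chiralCoeff ((Δ + ℓ) / 2) mm.1 * chiralCoeff ((Δ - ℓ) / 2) mm.2) *
        pairPow ((Δ + ℓ) / 2 + mm.1) ((Δ - ℓ) / 2 + mm.2) x y := by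
    funext x y
    rw [QN, Finset.sum_product]
  rw [hQ, crossF_finset_sum]
  have : (fun z zb => ∑ i ∈ range N ×ˢ range N,
      chiralCoeff ((Δ + ↑ℓ) / 2) i.1 * chiralCoeff ((Δ - ↑ℓ) / 2) i.2 *
        crossF s (-1) (pairPow ((Δ + ↑ℓ) / 2 + ↑i.1) ((Δ - ↑ℓ) / 2 + ↑i.2)) z zb) =
      ∑ i ∈ range N ×ˢ range N,
        (chiralCoeff ((Δ + ↑ℓ) / 2) i.1 * chiralCoeff ((Δ - ↑ℓ) / 2) i.2) •
          crossF s (-1) (pairPow ((Δ + ↑ℓ) / 2 + ↑i.1) ((Δ - ↑ℓ) / 2 + ↑i.2)) := by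
    funext z zb
    simp only [Finset.sum_apply, Pi.smul_apply, smul_eq_mul]
  rw [this, map_sum, Finset.sum_product]
  refine Finset.sum_congr rfl fun m _ => Finset.sum_congr rfl fun m' _ => ?_
  rw [map_smul, smul_eq_mul]

/-! ### The truncation lower bound -/

/-- **Truncation**: for an evaluation-continuous `φ` with the above-threshold obligation
`PairPositiveAbove φ s E₀`, every block with `ℓ ≤ Δ` and `Δ + N ≥ E₀` satisfies
`φ[F_-[Q_N]] ≤ φ[F_-[g_{Δ,ℓ}]]` (the dropped pairs are non-negative). PROVED. [folklore] -/
theorem phi_QN_le_block {φ : (ℝ → ℝ → ℝ) →ₗ[ℝ] ℝ} (hφ : EvaluationContinuous φ) {s E₀ : ℝ}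
    (hpair : PairPositiveAbove φ s E₀) {Δ : ℝ} {ℓ N : ℕ} (hΔ : (ℓ : ℝ) ≤ Δ) (hN : E₀ ≤ Δ + N) :
    φ (crossF s (-1) (QN N ℓ Δ)) ≤ φ (crossF s (-1) (globalBlock Δ ℓ)) := by
  have hℓ : (0 : ℝ) ≤ ℓ := Nat.cast_nonneg ℓ
  have hs := hφ.hasSum_mul
    (fun mm : ℕ × ℕ => chiralCoeff ((Δ + ℓ) / 2) mm.1 * chiralCoeff ((Δ - ℓ) / 2) mm.2)
    (fun mm => crossF s (-1) (pairPow ((Δ + ℓ) / 2 + (mm.1 : ℝ)) ((Δ - ℓ) / 2 + (mm.2 : ℝ))))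
    (crossF s (-1) (globalBlock Δ ℓ))
    (fun z zb hz hzb => hasSum_crossF_globalBlock hΔ hz hzb)
  rw [← TN_eq_phi_QN, ← Finset.sum_product (s := range N) (t := range N)
    (f := fun mm : ℕ × ℕ => chiralCoeff ((Δ + ℓ) / 2) mm.1 * chiralCoeff ((Δ - ℓ) / 2) mm.2 *
      φ (crossF s (-1) (pairPow ((Δ + ℓ) / 2 + mm.1) ((Δ - ℓ) / 2 + mm.2))))]
  refine sum_le_hasSum (range N ×ˢ range N) (fun mm hmm => ?_) hs
  -- a dropped pair: m ≥ N or m' ≥ N, so a + b = Δ + m + m' ≥ Δ + N ≥ E₀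
  have hout : N ≤ mm.1 ∨ N ≤ mm.2 := by
    simp only [Finset.mem_product, Finset.mem_range, not_and_or, not_lt] at hmm
    exact hmm
  refine mul_nonneg (mul_nonneg (chiralCoeff_nonneg (by linarith) _) (chiralCoeff_nonneg (by linarith) _))
    (hpair _ _ ?_ ?_ ?_ ⟨(ℓ : ℤ) + mm.1 - mm.2, ?_⟩)
  · have : (0 : ℝ) ≤ mm.1 := Nat.cast_nonneg _; linarith
  · have : (0 : ℝ) ≤ mm.2 := Nat.cast_nonneg _; linarith
  · have h1 : (0 : ℝ) ≤ mm.1 := Nat.cast_nonneg _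
    have h2 : (0 : ℝ) ≤ mm.2 := Nat.cast_nonneg _
    rcases hout with h | h
    · have : (N : ℝ) ≤ mm.1 := by exact_mod_cast h
      linarith
    · have : (N : ℝ) ≤ mm.2 := by exact_mod_cast h
      linarith
  · push_cast; ring

/-- **(C) from the truncated block**: `φ[F_-[Q_N]] ≥ 0 ⇒ φ[F_-[g_{Δ,ℓ}]] ≥ 0` under the same
hypotheses. [folklore] -/
theorem blockPositive_of_QN_nonneg {φ : (ℝ → ℝ → ℝ) →ₗ[ℝ] ℝ} (hφ : EvaluationContinuous φ)
    {s E₀ : ℝ} (hpair : PairPositiveAbove φ s E₀) {Δ : ℝ} {ℓ N : ℕ} (hΔ : (ℓ : ℝ) ≤ Δ)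
    (hN : E₀ ≤ Δ + N) (h : 0 ≤ φ (crossF s (-1) (QN N ℓ Δ))) : BlockPositive φ s Δ ℓ :=
  h.trans (phi_QN_le_block hφ hpair hΔ hN)

/-! ### The value of `φ[F_-[Q_N]]` at a point functional -/

/-- **`φ[F_-[Q_N]]` for a point functional** with nodes in the open square, in closed form (even `ℓ`):
`Σ_k w_k (v_k^s (z_k z̄_k)^{Δ/2} brR(z_k, z̄_k) - u_k^s ((1-z_k)(1-z̄_k))^{Δ/2} brR(1-z_k, 1-z̄_k))`.
[folklore] -/
theorem pointFunctional_crossF_QN {n : ℕ} (w z zb : Fin n → ℝ) (hz : ∀ k, z k ∈ Ioo (0 : ℝ) 1)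
    (hzb : ∀ k, zb k ∈ Ioo (0 : ℝ) 1) (s : ℝ) {N ℓ : ℕ} (hℓ : Even ℓ) (Δ : ℝ) :
    pointFunctional w z zb (crossF s (-1) (QN N ℓ Δ)) =
      ∑ k, w k * (((1 - z k) * (1 - zb k)) ^ s * ((z k * zb k) ^ (Δ / 2) * brR N ℓ Δ (z k) (zb k)) -
        (z k * zb k) ^ s * (((1 - z k) * (1 - zb k)) ^ (Δ / 2) * brR N ℓ Δ (1 - z k) (1 - zb k))) := by
  rw [pointFunctional_apply]
  refine Finset.sum_congr rfl fun k _ => ?_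
  have hx := (hz k).1; have hx1 := (hz k).2; have hy := (hzb k).1; have hy1 := (hzb k).2
  simp only [crossF]
  rw [QN_eq hℓ hx hy, QN_eq hℓ (by linarith) (by linarith)]
  ring

end Summit.CriticalPhenomena.Ising3D.Control2D
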